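import Literature.NumberTheory.QuadraticForms.TernaryAnisotropicPlaces
import Literature.NumberTheory.QuadraticForms.HasseInvariantFrames
import HarnessLib

/-!
# The product formula for the Hasse invariants `ε_v` (Serre IV §3.3 Remark (1); Hilbert reciprocity)

Topic `NumberTheory/QuadraticForms`; namespace `Literature.NumberTheory.QuadraticForms`. Everything here
is proved. Serre, *A Course in Arithmetic*, Ch. IV §3.3 Remark: the invariants `ε_v = ε_v(f)` of a
rational quadratic form satisfy "(1) `ε_v = 1` for almost all `v ∈ V` and `∏ ε_v = 1`" — because
`ε_v(f) = ∏_{i<j} (aᵢ, aⱼ)_v` and each family `(aᵢ, aⱼ)_v` satisfies Hilbert's product formula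
(Ch. III §2.1 Thm 3; over a number field `K`: O'Meara 71:18, the tree's named fact
`hilbertReciprocity K a b`, stated as "the places with symbol `-1` are finite and even in number" and
proved for `K = ℚ` as `hilbertReciprocity_rat`). This file proves the product formula for `ε` in that
form — the set of finite places `v` of `K` with `ε_v(f) = -1` is finite, and together with the
archimedean places with `ε_w(f) = -1` it has even cardinality — for diagonal forms over any number field
`K` satisfying Hilbert reciprocity for the pairs of coefficients, unconditionally over `ℚ`. The
combinatorial heart is the parity count for a pointwise product of two `±1`-valued functions
(`(-1)^{#\{fg = -1\}} = (-1)^{#\{f = -1\}} (-1)^{#\{g = -1\}}`).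

* `hasseProd_places_even` — number field `K`, from `hilbertReciprocity K (cᵢ) (cⱼ)`;
* `rat_hasseProd_places_even` — `K = ℚ`, unconditional.

## References

* J.-P. Serre, *A Course in Arithmetic*, GTM 7, Springer 1973, Ch. IV §3.3 Remark (1), Ch. III §2.1
  Thm 3 [corpus:book:serre1973-course-arithmetic p0042]. [Serre1973]
* O. T. O'Meara, *Introduction to Quadratic Forms*, Grundlehren 117, Springer 1963, §71 Thm 71:18,
  §72 [corpus:book:o-meara1963-introduction-quadratic-forms p0194]. [Omeara1963]
-/

noncomputable section

open Finset NumberField IsDedekindDomain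

namespace Literature.NumberTheory.QuadraticForms

/-! ### Parity of the `-1`'s of a product of sign functions -/

section Signs

variable {V : Type*}

/-- A `±1`-valued function is `-1` on a subset of a finset `S` iff its product over `S` is
`(-1)^{#\{= -1\}}`. [folklore] -/
private theorem prod_eq_neg_one_pow_ncard [DecidableEq V] {h : V → ℤ} (hh : ∀ v, h v = 1 ∨ h v = -1)
    (S : Finset V) (hS : {v | h v = -1} ⊆ (S : Set V)) :
    ∏ v ∈ S, h v = (-1) ^ {v | h v = -1}.ncard := by
  classical
  have hset : {v | h v = -1} = (S.filter fun v => h v = -1 : Finset V) := by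
    ext v
    simp only [Set.mem_setOf_eq, coe_filter]
    exact ⟨fun hv => ⟨hS hv, hv⟩, fun hv => hv.2⟩
  rw [hset, Set.ncard_coe_finset, ← prod_filter_mul_prod_filter_not S (fun v => h v = -1)]
  rw [prod_congr rfl (fun v hv => (mem_filter.mp hv).2), prod_const,
    prod_eq_one (fun v hv => ?_), mul_one]
  rcases hh v with h1 | h1
  · exact h1
  · exact absurd h1 (mem_filter.mp hv).2

/-- A product of two `±1`-valued functions is `±1`-valued. [folklore] -/
private theorem sign_mul_sign {f g : V → ℤ} (hf : ∀ v, f v = 1 ∨ f v = -1) (hg : ∀ v, g v = 1 ∨ g v = -1)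
    (v : V) : f v * g v = 1 ∨ f v * g v = -1 := by
  rcases hf v with h | h <;> rcases hg v with h' | h' <;> simp [h, h']

/-- The `-1`-set of a product of sign functions is finite if both `-1`-sets are. [folklore] -/
private theorem finite_setOf_mul_eq_neg_one {f g : V → ℤ} (hf : ∀ v, f v = 1 ∨ f v = -1)
    (hg : ∀ v, g v = 1 ∨ g v = -1) (hF : {v | f v = -1}.Finite) (hG : {v | g v = -1}.Finite) :
    {v | f v * g v = -1}.Finite := by
  refine (hF.union hG).subset fun v hv => ?_
  simp only [Set.mem_setOf_eq, Set.mem_union] at hv ⊢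
  rcases hf v with h | h <;> rcases hg v with h' | h' <;> simp_all

/-- **Parity count for a product of sign functions**:
`(-1)^{#\{fg = -1\}} = (-1)^{#\{f = -1\}} (-1)^{#\{g = -1\}}`. [folklore] -/
private theorem neg_one_pow_ncard_mul {f g : V → ℤ} (hf : ∀ v, f v = 1 ∨ f v = -1)
    (hg : ∀ v, g v = 1 ∨ g v = -1) (hF : {v | f v = -1}.Finite) (hG : {v | g v = -1}.Finite) :
    (-1 : ℤ) ^ {v | f v * g v = -1}.ncard = (-1) ^ {v | f v = -1}.ncard * (-1) ^ {v | g v = -1}.ncard := by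
  classical
  set S : Finset V := (hF.union hG).toFinset with hSdef
  have hSf : {v | f v = -1} ⊆ (S : Set V) := fun v hv => by
    simp only [hSdef, Set.Finite.coe_toFinset]
    exact Or.inl hv
  have hSg : {v | g v = -1} ⊆ (S : Set V) := fun v hv => by
    simp only [hSdef, Set.Finite.coe_toFinset]
    exact Or.inr hv
  have hSfg : {v | f v * g v = -1} ⊆ (S : Set V) := fun v hv => by
    simp only [hSdef, Set.Finite.coe_toFinset, Set.mem_union, Set.mem_setOf_eq]
    simp only [Set.mem_setOf_eq] at hv
    rcases hf v with h | h <;> rcases hg v with h' | h' <;> simp_all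
  rw [← prod_eq_neg_one_pow_ncard hf S hSf, ← prod_eq_neg_one_pow_ncard hg S hSg,
    ← prod_eq_neg_one_pow_ncard (sign_mul_sign hf hg) S hSfg, prod_mul_distrib]

end Signs

/-! ### Reciprocity data: pairs of sign functions on the finite and infinite places -/

section Places

variable {K : Type} [Field K] [NumberField K]

/-- **Products of reciprocity families are reciprocity families**: if `f`, `g` are `±1`-valued families
on the places of `K`, each `-1` at finitely many finite places and at an even total number of places,
then so is `fg`. [folklore] -/
private theorem places_even_mul {f₁ g₁ : HeightOneSpectrum (𝓞 K) → ℤ} {f₂ g₂ : InfinitePlace K → ℤ}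
    (hf₁ : ∀ v, f₁ v = 1 ∨ f₁ v = -1) (hg₁ : ∀ v, g₁ v = 1 ∨ g₁ v = -1)
    (hf₂ : ∀ w, f₂ w = 1 ∨ f₂ w = -1) (hg₂ : ∀ w, g₂ w = 1 ∨ g₂ w = -1)
    (hf : {v | f₁ v = -1}.Finite ∧ Even ({v | f₁ v = -1}.ncard + {w | f₂ w = -1}.ncard))
    (hg : {v | g₁ v = -1}.Finite ∧ Even ({v | g₁ v = -1}.ncard + {w | g₂ w = -1}.ncard)) :
    {v | f₁ v * g₁ v = -1}.Finite ∧
      Even ({v | f₁ v * g₁ v = -1}.ncard + {w | f₂ w * g₂ w = -1}.ncard) := by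
  have hne : (-1 : ℤ) ≠ 1 := by norm_num
  refine ⟨finite_setOf_mul_eq_neg_one hf₁ hg₁ hf.1 hg.1, ?_⟩
  rw [← neg_one_pow_eq_one_iff_even hne] at hf hg ⊢
  obtain ⟨hF, hfe⟩ := hf
  obtain ⟨hG, hge⟩ := hg
  rw [pow_add] at hfe hge ⊢
  rw [neg_one_pow_ncard_mul hf₁ hg₁ hF hG,
    neg_one_pow_ncard_mul hf₂ hg₂ (Set.toFinite _) (Set.toFinite _)]
  linear_combination ((-1 : ℤ) ^ {v | g₁ v = -1}.ncard * (-1) ^ {w | g₂ w = -1}.ncard) * hfe + hge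

omit [NumberField K] in
/-- The trivial reciprocity family `1`. [folklore] -/
private theorem places_even_one :
    {v : HeightOneSpectrum (𝓞 K) | (fun _ => (1 : ℤ)) v = -1}.Finite ∧
      Even ({v : HeightOneSpectrum (𝓞 K) | (fun _ => (1 : ℤ)) v = -1}.ncard +
        {w : InfinitePlace K | (fun _ => (1 : ℤ)) w = -1}.ncard) := by
  have h1 : {v : HeightOneSpectrum (𝓞 K) | (fun _ => (1 : ℤ)) v = -1} = ∅ :=
    Set.eq_empty_iff_forall_notMem.mpr fun v hv => by norm_num at hv
  have h2 : {w : InfinitePlace K | (fun _ => (1 : ℤ)) w = -1} = ∅ :=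
    Set.eq_empty_iff_forall_notMem.mpr fun w hw => by norm_num at hw
  rw [h1, h2]
  simp

/-- **Finite products of reciprocity families are reciprocity families.** [folklore] -/
private theorem places_even_prod {ι : Type*} (s : Finset ι)
    (f₁ : ι → HeightOneSpectrum (𝓞 K) → ℤ) (f₂ : ι → InfinitePlace K → ℤ)
    (hf₁ : ∀ i v, f₁ i v = 1 ∨ f₁ i v = -1) (hf₂ : ∀ i w, f₂ i w = 1 ∨ f₂ i w = -1)
    (h : ∀ i ∈ s, {v | f₁ i v = -1}.Finite ∧ Even ({v | f₁ i v = -1}.ncard + {w | f₂ i w = -1}.ncard)) :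
    {v | (∏ i ∈ s, f₁ i v) = -1}.Finite ∧
      Even ({v | (∏ i ∈ s, f₁ i v) = -1}.ncard + {w | (∏ i ∈ s, f₂ i w) = -1}.ncard) := by
  classical
  induction s using Finset.induction_on with
  | empty => simp
  | insert a s ha ih =>
    have hs1 : ∀ v, (∏ i ∈ s, f₁ i v) = 1 ∨ (∏ i ∈ s, f₁ i v) = -1 := fun v =>
      Finset.prod_induction _ (fun x : ℤ => x = 1 ∨ x = -1)
        (fun x y hx hy => by rcases hx with rfl | rfl <;> rcases hy with rfl | rfl <;> simp)
        (Or.inl rfl) fun i _ => hf₁ i v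
    have hs2 : ∀ w, (∏ i ∈ s, f₂ i w) = 1 ∨ (∏ i ∈ s, f₂ i w) = -1 := fun w =>
      Finset.prod_induction _ (fun x : ℤ => x = 1 ∨ x = -1)
        (fun x y hx hy => by rcases hx with rfl | rfl <;> rcases hy with rfl | rfl <;> simp)
        (Or.inl rfl) fun i _ => hf₂ i w
    simp only [Finset.prod_insert ha]
    exact places_even_mul (hf₁ a) hs1 (hf₂ a) hs2 (h a (mem_insert_self a s))
      (ih fun i hi => h i (mem_insert_of_mem hi))

/-! ### The product formula for `ε` -/

/-- **The product formula for the Hasse invariants** (Serre, Ch. IV §3.3 Remark (1): "`ε_v = 1` for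
almost all `v ∈ V` and `∏ ε_v = 1`"; over a number field from Hilbert reciprocity, O'Meara 71:18, for the
pairs `(cᵢ, cⱼ)`): for a diagonal form `⟨c⟩` over a number field `K` satisfying Hilbert reciprocity for
all pairs of its coefficients, the finite places `v` with `ε_v(c) = -1` form a finite set, and together
with the archimedean places `w` with `ε_w(c) = -1` they are even in number.
[cite: Serre1973, Ch. IV §3.3 Remark (1)] -/
theorem hasseProd_places_even {n : ℕ} (c : Fin n → K)
    (hrec : ∀ i j, hilbertReciprocity K (c i) (c j)) (hc : ∀ i, c i ≠ 0) :
    {v : HeightOneSpectrum (𝓞 K) |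
        hasseProd (hilbertSymbol (v.adicCompletion K)) (fun i => algebraMap K (v.adicCompletion K) (c i)) = -1}.Finite ∧
      Even ({v : HeightOneSpectrum (𝓞 K) |
          hasseProd (hilbertSymbol (v.adicCompletion K))
            (fun i => algebraMap K (v.adicCompletion K) (c i)) = -1}.ncard +
        {w : InfinitePlace K |
          hasseProd (hilbertSymbol w.Completion) (fun i => algebraMap K w.Completion (c i)) = -1}.ncard) := by
  -- the families `(cᵢ, cⱼ)_v` for `i < j`, and `1` otherwise
  let g₁ : Fin n → Fin n → HeightOneSpectrum (𝓞 K) → ℤ := fun i j v =>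
    if i < j then hilbertSymbol (v.adicCompletion K) (algebraMap K _ (c i)) (algebraMap K _ (c j)) else 1
  let g₂ : Fin n → Fin n → InfinitePlace K → ℤ := fun i j w =>
    if i < j then hilbertSymbol w.Completion (algebraMap K _ (c i)) (algebraMap K _ (c j)) else 1
  have hg₁ : ∀ i j v, g₁ i j v = 1 ∨ g₁ i j v = -1 := fun i j v => by
    simp only [g₁]
    split_ifs
    · exact hilbertSymbol_eq_one_or_eq_neg_one _ _
    · exact Or.inl rfl
  have hg₂ : ∀ i j w, g₂ i j w = 1 ∨ g₂ i j w = -1 := fun i j w => by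
    simp only [g₂]
    split_ifs
    · exact hilbertSymbol_eq_one_or_eq_neg_one _ _
    · exact Or.inl rfl
  -- each pair family is a reciprocity family
  have hpair : ∀ i j, {v | g₁ i j v = -1}.Finite ∧
      Even ({v | g₁ i j v = -1}.ncard + {w | g₂ i j w = -1}.ncard) := by
    intro i j
    by_cases hij : i < j
    · simpa [g₁, g₂, hij] using hrec i j (hc i) (hc j)
    · simp [g₁, g₂, hij]
  -- inner products over `j`, then outer products over `i`
  have hinner : ∀ i, {v | (∏ j, g₁ i j v) = -1}.Finite ∧
      Even ({v | (∏ j, g₁ i j v) = -1}.ncard + {w | (∏ j, g₂ i j w) = -1}.ncard) := fun i =>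
    places_even_prod univ (g₁ i) (g₂ i) (hg₁ i) (hg₂ i) fun j _ => hpair i j
  have hs1 : ∀ i v, (∏ j, g₁ i j v) = 1 ∨ (∏ j, g₁ i j v) = -1 := fun i v =>
    Finset.prod_induction _ (fun x : ℤ => x = 1 ∨ x = -1)
      (fun x y hx hy => by rcases hx with rfl | rfl <;> rcases hy with rfl | rfl <;> simp)
      (Or.inl rfl) fun j _ => hg₁ i j v
  have hs2 : ∀ i w, (∏ j, g₂ i j w) = 1 ∨ (∏ j, g₂ i j w) = -1 := fun i w =>
    Finset.prod_induction _ (fun x : ℤ => x = 1 ∨ x = -1)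
      (fun x y hx hy => by rcases hx with rfl | rfl <;> rcases hy with rfl | rfl <;> simp)
      (Or.inl rfl) fun j _ => hg₂ i j w
  have houter := places_even_prod univ (fun i v => ∏ j, g₁ i j v) (fun i w => ∏ j, g₂ i j w) hs1 hs2
    fun i _ => hinner i
  -- this is `ε`
  exact houter

/-- **The product formula for the Hasse invariants of a rational form** (Serre, Ch. IV §3.3 Remark (1),
unconditionally from `hilbertReciprocity_rat`): the finite places of `ℚ` with `ε_v(c) = -1` are finite in
number and, counted together with the infinite place if `ε_∞(c) = -1`, even in number.
[cite: Serre1973, Ch. IV §3.3 Remark (1)] -/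
theorem rat_hasseProd_places_even {n : ℕ} (c : Fin n → ℚ) (hc : ∀ i, c i ≠ 0) :
    {v : HeightOneSpectrum (𝓞 ℚ) |
        hasseProd (hilbertSymbol (v.adicCompletion ℚ)) (fun i => algebraMap ℚ (v.adicCompletion ℚ) (c i)) = -1}.Finite ∧
      Even ({v : HeightOneSpectrum (𝓞 ℚ) |
          hasseProd (hilbertSymbol (v.adicCompletion ℚ))
            (fun i => algebraMap ℚ (v.adicCompletion ℚ) (c i)) = -1}.ncard +
        {w : InfinitePlace ℚ |
          hasseProd (hilbertSymbol w.Completion) (fun i => algebraMap ℚ w.Completion (c i)) = -1}.ncard) :=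
  hasseProd_places_even c (fun i j => hilbertReciprocity_rat (c i) (c j)) hc

end Places

end Literature.NumberTheory.QuadraticForms

end
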